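import Literature.MathematicalPhysics.QuantumFieldTheory.Balaban1983to89.B12Decay510Holo
import Literature.MathematicalPhysics.QuantumFieldTheory.Balaban1983to89.Beta.RemainderLocality
import Literature.Analysis.Complex.HolomorphicBanach

/-!
# `Balaban1983to89.NodeOJetCalculus` — SECOND-ORDER JETS AT A BASE POINT of holomorphic functions on a complex normed space:
# the Taylor polynomial of order two, symmetry of the mixed derivative, the order-two chain rule and JET TRANSPORT
# (S. B. Chae, *Holomorphy and Calculus in Normed Spaces* (1985) [Chae1985] 5.9, 7.4, 7.13, 8.6–8.7, 13.6, 14.13 — the calculus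
# behind T. Bałaban, CMP **109** (1987) [Balaban1987RG1] (4.3)–(4.5) pp. 281–282 and (1.20)–(1.22) p. 264)

statement-level skeleton of published theorems with citation tags; proofs where landed; nothing here is a claim about the Yang–Mills mass gap

CITATION HEADER (lean-in-tree rule).  Ideation cell `ym-nodeO-ideate` (portfolio track, 2026-08-25), seat P3 «weaken the target», memo
`memos/ROUTE-P3.md` v3.15 (sha256 756f0b72…) §0.16 ∕ §2 row W-jet2 ∕ §9 nomination N1.  LANDING EDITION (generation 14) of §1, §7 and
§8–§8b of the memo companion `memos/ROUTE-P3-SketchJet.lean` («JT», sha256 be2c53c0…, 794 l., 0 `sorry`, 0 `axiom` declarations — the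
referee's «2 deep END axioms standard» records `#print axioms` = [propext, Classical.choice, Quot.sound] on its two deepest ENDs; referee
REF g18 PASS 2026-08-25T17:49:30Z, ROUND VERDICT 17:50:10Z name (3) «P3 N1: JT §7–§8 second-order calculus over `HolomorphicBanach` +
prelude»; director-ym LINE №2 (B); LIT g6 cite map 18:33:31Z).  Statements and proofs below are CHARACTER-IDENTICAL to the companion's
(JT :75–:170, :485–:548, :585–:605, :634–:730); edition deltas = the namespace (`YM.NodeO.P3.Jet` → this module's), this header, the
imports narrowed to what these sections use (`B12Decay510Holo`: `mixedDeriv` (4.3) and its additivity ∕ homogeneity ∕ Cauchy lemmas;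
`Beta.RemainderLocality`: `mixedDeriv_eq_fderiv_fderiv`; `Literature.Analysis.Complex.HolomorphicBanach`: `hasFDerivAt_fderiv`, [Chae1985]
Thm 14.13), a docstring on `jet2_zero`, per-declaration `[cite: <key>, <locator>]` tags (Chae item numbers read from the held text; Bałaban
locators per LIT `lit/SOURCES.md` v2.75 §6 ∕ §1.1), the two section banners of §7 ∕ §8 shortened to what remains in them, and the CUT of
every KERNEL-LEVEL declaration of JT (§2–§6: `kjet`, `Kernel216R`, `Jet216R` and its fields ∕ corollaries, `jetTerms`, `AcrossOn216R`,
`AcrossJet2`, `acrossOn216R_jet`, `acrossJet2_of_acrossSmall`; §7 `Jet216R.jet_agreement_G2`; §8 `kjet_A2_isSymm`, `Jet216R.jet_agreement_A2`;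
§8c `entries`, `Jet216R.objects_jet_agreement`) — they are the memo's nomination N2 («(2.16)-level sockets»), to be filed only after this
module.  The companion's closing `#print axioms` lines are dropped (the gate reports axioms).
LABELS inside the docstrings (memo-side words, NOT tree declarations): «the wall» ∕ «the (D4) wall» = the tree's
`Beta.RemainderStepAdapterHolo.remainderConst_of_stepLeafLists` with its read-outs `E2n` (:240) ∕ `ha` (:366); «price (J2)» = memo census C88's
objects-side identification step; «jet family», «`Jet216R`», «§2b», «§5», «§7» = the companion JT's objects ∕ section numbers (N2).

PRINT STATUS (LIT §6 card).  PROVED IN PRINT as textbook analysis — [Chae1985]: 5.9 (chain rule), 7.3–7.4 (the second differential is a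
continuous SYMMETRIC bilinear map — Schwarz), 7.13 (commutativity of directional derivatives), 8.6–8.7 (Taylor polynomials `T_{m,f,ξ}` and
`dT_{m,f,ξ} = T_{m−1,df,ξ}`), 13.6 (Cauchy inequalities `‖(1∕m!) d̂ᵐf(ξ)‖ ≤ r⁻ᵐ sup_{‖x−ξ‖=r} ‖f(x)‖`), 14.13 (Fréchet-differentiable ⟺
holomorphic on complex Banach spaces; the tree's `HolomorphicBanach` formalises it and supplies the second differentials used here on ANY
complex normed domain); «[folklore] relative to Mathlib» (Mathlib at the tree's pin has `second_derivative_symmetric_of_eventually` but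
no Banach-domain `DifferentiableOn → AnalyticOnNhd`).  Bałaban's USE of this calculus, cited for context only: [Balaban1987RG1] (4.3)
p. 281 (differentiation of the composite effective action by Cauchy integrals), (4.4)–(4.5) pp. 281–282 (the bilinear Cauchy estimate on
the `α₂`-ball), (1.20)–(1.22) p. 264 (the polarization `Π_{j+1}` ∕ `β` read off SECOND derivatives at the zero field).  Print has NO «jet»
object and says nothing here about Bałaban's kernels; every `[cite:]` tag names the printed statement the lemma TRANSCRIBES or SERVES.

WHAT IS PROVED (sorry-free, axiom-free; `E` any complex normed space, `M` a complete one; scalar targets `ℂ`; the tree's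
`mixedDeriv f v w = deriv (τ ↦ fderiv ℂ f (τ•w) v) 0`, `B12Decay510` (4.3)).
* §1 `jet2 f v = f 0 + Df(0)v + ½ ∂²f(v,v)` (Chae 8.6, `m = 2`, `ξ = 0`); `isBoundedBilinearMap_mixedDeriv` (7.3); `differentiable_jet2`
  (the jet polynomial is ENTIRE); `norm_jet2_sub_le` ∕ `jet_budget_le` (`‖jet2 f v − f 0‖ ≤ K₁‖v‖ + ½K₂‖v‖²` from letters on `Df(0)`, `∂²f`,
  and its value on the `α`-ball); `norm_fderiv_apply_le_of_ball` (13.6 (a), `m = 1`, limit form `r ↑ R` on the open ball).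
* §7 `mixedDeriv_symm` (7.4 + 7.13 via 14.13: `∂²f(v,w) = ∂²f(w,v)` for `f` holomorphic on a ball); `hasFDerivAt_jet2`, `fderiv_jet2_zero`,
  `mixedDeriv_jet2` (8.7: the jet polynomial has at `0` the same first derivative and, by polarization + symmetry, the same mixed second
  derivatives as `f`, in EVERY pair of directions).
* §8 `jet2_congr` (germ-dependence); `chain_formula` (5.9 at order two: `D(Φ∘k)(0) = DΦ(k0)∘Dk(0)`,
  `∂²(Φ∘k)(v,w) = DΦ(k0)[∂_w∂_v k(0)] + ∂_{Dk(0)w}∂_{Dk(0)v}Φ(k0)`); **`jet_transport`** (two holomorphic germs `k, k' : E → M` with the same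
  second-order jet at `0` give, for every holomorphic `Φ : M → ℂ`, composites `Φ∘k`, `Φ∘k'` with the same value, first derivative and mixed
  second derivatives at `0`); §8b **`jet_transport_pi`** (entrywise form, `M = ι → ℂ`, `ι` finite).
USE IN THE CELL (memo v3.15 row W-jet2, not a tree claim): the β-road's remainder wall `Beta.RemainderStepAdapterHolo` reads its step objects
only through value ∕ `fderiv` ∕ `mixedDeriv` at the base configuration, so any re-presentation of the objects agreeing to second order there
(restriction to a seam, a polynomial lift, a producer's perturbative objects) feeds its identification binders — `jet_transport` is that step.

WHAT THIS IS NOT.  NOT a statement about Bałaban's kernels, propagators or renormalisation transformations; NOT NODE O (no inhabitant or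
weakening of `B13TermWalkDataOneTorus.ExistsUniformAcrossSmall` :353 is produced or claimed), NOT [B12] Thm 2, NOT the memo's kernel-level jet
family (N2); no YM-PLAN ∕ Track-B node is claimed closed and no Track-B number is produced; not continuum, not mass gap, not Clay.  NEW file,
imports built tree modules only; nothing modified.  Dimension-free (no lattice, no `d`).  Net new unproved facts: 0.
[cite: Chae1985, Thm 5.9, Thm 7.4, Thm 7.13, 8.6–8.7, 13.6, Thm 14.13; Balaban1987RG1, (4.3)–(4.5) pp.281–282, (1.20)–(1.22) p.264] -/

noncomputable section

open Metric Set Filter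
open scoped Topology

namespace Literature.MathematicalPhysics.QuantumFieldTheory.Balaban1983to89.NodeOJetCalculus

open Literature.MathematicalPhysics.QuantumFieldTheory.Balaban1983to89.B12Decay510 (mixedDeriv)
open Literature.MathematicalPhysics.QuantumFieldTheory.Balaban1983to89.B12Decay510Holo
open Literature.Analysis.Complex

/-! ## §1  Second-order jets at the base point of scalar functions on a complex normed space -/

section Jet2

variable {E : Type*} [NormedAddCommGroup E] [NormedSpace ℂ E]

/-- **THE SECOND-ORDER TAYLOR POLYNOMIAL AT `0`** of `f : E → ℂ`, in the wall's own currency: value, Fréchet derivative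
at `0`, and the mixed derivative `mixedDeriv f v v = ∂²∕∂τ₁∂τ₂ f(τ₁v + τ₂v)∣₀` (`B12Decay510` :468) on the diagonal.
DATA ([folklore] plumbing: Chae's Taylor polynomial `T_{2,f,0}`). [cite: Chae1985, 8.6; Balaban1987RG1, (1.20)–(1.22) p.264] -/
def jet2 (f : E → ℂ) (v : E) : ℂ :=
  f 0 + fderiv ℂ f 0 v + (1 / 2 : ℂ) * mixedDeriv f v v

/-- `T_{2,f,0}(0) = f 0`. [cite: Chae1985, 8.6] -/
@[simp] theorem jet2_zero (f : E → ℂ) : jet2 f 0 = f 0 := by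
  simp [jet2, mixedDeriv]

/-- The mixed derivative at the base point of a function complex-differentiable near `0` with a bilinear bound is a
bounded bilinear map ([I] (4.3)∕(1.20): the second 𝐀-derivative is a bilinear form; tree `B12Decay510Holo.mixedDeriv_add_left`
… `mixedDeriv_smul_right`). [cite: Chae1985, 7.3, Thm 14.13; Balaban1987RG1, (4.3) p.281, (1.20) p.264] -/
theorem isBoundedBilinearMap_mixedDeriv {f : E → ℂ} {ρ K₂ : ℝ} (hρ : 0 < ρ) (hf : DifferentiableOn ℂ f (ball 0 ρ))
    (h2 : ∀ v w, ‖mixedDeriv f v w‖ ≤ K₂ * ‖v‖ * ‖w‖) :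
    IsBoundedBilinearMap ℂ (fun q : E × E => mixedDeriv f q.1 q.2) where
  add_left := fun v₁ v₂ w => mixedDeriv_add_left hρ hf v₁ v₂ w
  smul_left := fun t v w => by rw [smul_eq_mul]; exact mixedDeriv_smul_left hρ hf t v w
  add_right := fun v w₁ w₂ => mixedDeriv_add_right hρ hf v w₁ w₂
  smul_right := fun t v w => by rw [smul_eq_mul]; exact mixedDeriv_smul_right hρ hf t v w
  bound := ⟨|K₂| + 1, by positivity, fun v w => (h2 v w).trans
    (mul_le_mul_of_nonneg_right (mul_le_mul_of_nonneg_right (by linarith [le_abs_self K₂]) (norm_nonneg _))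
      (norm_nonneg _))⟩

/-- **The jet polynomial is ENTIRE** (constant + continuous linear + diagonal of a bounded bilinear map); [folklore] relative to Mathlib. [cite: Chae1985, Thm 5.14, 8.6] -/
theorem differentiable_jet2 {f : E → ℂ} {ρ K₂ : ℝ} (hρ : 0 < ρ) (hf : DifferentiableOn ℂ f (ball 0 ρ))
    (h2 : ∀ v w, ‖mixedDeriv f v w‖ ≤ K₂ * ‖v‖ * ‖w‖) : Differentiable ℂ (jet2 f) := by
  have hq : Differentiable ℂ (fun v : E => mixedDeriv f v v) :=
    (isBoundedBilinearMap_mixedDeriv hρ hf h2).differentiable.comp (differentiable_id.prodMk differentiable_id)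
  show Differentiable ℂ (fun v => f 0 + fderiv ℂ f 0 v + (1 / 2 : ℂ) * mixedDeriv f v v)
  exact ((differentiable_const _).add (fderiv ℂ f 0).differentiable).add ((differentiable_const _).mul hq)

/-- **The jet letters bound the jet's excursion from the base value**: `‖jet2 f v − f 0‖ ≤ K₁‖v‖ + ½K₂‖v‖²`
([folklore] triangle inequality on Chae's `T_{2,f,0} − f(0)`). [cite: Chae1985, 8.6; Balaban1987RG1, (4.4) p.281] -/
theorem norm_jet2_sub_le {f : E → ℂ} {K₁ K₂ : ℝ} (h1 : ∀ v, ‖fderiv ℂ f 0 v‖ ≤ K₁ * ‖v‖)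
    (h2 : ∀ v w, ‖mixedDeriv f v w‖ ≤ K₂ * ‖v‖ * ‖w‖) (v : E) :
    ‖jet2 f v - f 0‖ ≤ K₁ * ‖v‖ + 1 / 2 * K₂ * ‖v‖ ^ 2 := by
  have e : jet2 f v - f 0 = fderiv ℂ f 0 v + (1 / 2 : ℂ) * mixedDeriv f v v := by
    simp only [jet2]; ring
  have hhalf : ‖(1 / 2 : ℂ)‖ = 1 / 2 := by rw [norm_div, norm_one, Complex.norm_two]
  rw [e]
  calc ‖fderiv ℂ f 0 v + (1 / 2 : ℂ) * mixedDeriv f v v‖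
      ≤ ‖fderiv ℂ f 0 v‖ + ‖(1 / 2 : ℂ) * mixedDeriv f v v‖ := norm_add_le _ _
    _ = ‖fderiv ℂ f 0 v‖ + 1 / 2 * ‖mixedDeriv f v v‖ := by rw [norm_mul, hhalf]
    _ ≤ K₁ * ‖v‖ + 1 / 2 * (K₂ * ‖v‖ * ‖v‖) :=
        add_le_add (h1 v) (mul_le_mul_of_nonneg_left (h2 v v) (by norm_num))
    _ = K₁ * ‖v‖ + 1 / 2 * K₂ * ‖v‖ ^ 2 := by ring

omit [NormedSpace ℂ E] in
/-- The located jet budget at radius `α`: for `‖v‖ ≤ α`, `0 ≤ K₁, K₂, g`,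
`K₁g‖v‖ + ½(K₂g)‖v‖² ≤ (K₁α + ½K₂α²)·g` ([folklore] real arithmetic; the radius `α` of (4.4)). [cite: Balaban1987RG1, (4.4) p.281] -/
theorem jet_budget_le {K₁ K₂ g α : ℝ} (hK₁ : 0 ≤ K₁) (hK₂ : 0 ≤ K₂) (hg : 0 ≤ g) {v : E} (hv : ‖v‖ ≤ α) :
    K₁ * g * ‖v‖ + 1 / 2 * (K₂ * g) * ‖v‖ ^ 2 ≤ (K₁ * α + 1 / 2 * K₂ * α ^ 2) * g := by
  have h1 : ‖v‖ ^ 2 ≤ α ^ 2 := pow_le_pow_left₀ (norm_nonneg v) hv 2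
  have h2 : K₁ * g * ‖v‖ ≤ K₁ * g * α := mul_le_mul_of_nonneg_left hv (mul_nonneg hK₁ hg)
  have h3 : 1 / 2 * (K₂ * g) * ‖v‖ ^ 2 ≤ 1 / 2 * (K₂ * g) * α ^ 2 :=
    mul_le_mul_of_nonneg_left h1 (by positivity)
  nlinarith [h2, h3]

/-- **FIRST-ORDER CAUCHY ESTIMATE ON A BALL** (limit form): `f` complex-differentiable on `‖u‖ < R` with `‖f‖ ≤ S` there ⟹
`‖Df(0)v‖ ≤ (S∕R)‖v‖` (tree `SCV.norm_fderiv_apply_le` on the discs `|τ| ≤ ρ∕‖v‖`, `ρ < R`, then `ρ ↑ R` as in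
`B12Decay510Holo.norm_mixedDeriv_le_of_differentiableOn`): Chae's Cauchy inequality 13.6 (a) at `m = 1` on the open ball.
[cite: Chae1985, 13.6; Balaban1987RG1, (4.5) p.282] -/
theorem norm_fderiv_apply_le_of_ball {f : E → ℂ} {R S : ℝ} (hR : 0 < R) (hf : DifferentiableOn ℂ f (ball 0 R))
    (hS : ∀ u ∈ ball (0 : E) R, ‖f u‖ ≤ S) (v : E) : ‖fderiv ℂ f 0 v‖ ≤ S / R * ‖v‖ := by
  have hS0 : 0 ≤ S := (norm_nonneg _).trans (hS 0 (mem_ball_self hR))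
  by_cases hv : v = 0
  · subst hv; rw [map_zero, norm_zero, norm_zero, mul_zero]
  have hv' : 0 < ‖v‖ := norm_pos_iff.2 hv
  -- the estimate on every closed sub-disc of radius ρ < R
  have key : ∀ ρ, 0 < ρ → ρ < R → ‖fderiv ℂ f 0 v‖ ≤ S / ρ * ‖v‖ := by
    intro ρ hρ hρR
    have hr : 0 < ρ / ‖v‖ := div_pos hρ hv'
    have hsub : ∀ t ∈ closedBall (0 : ℂ) (ρ / ‖v‖), (0 : E) + t • v ∈ ball (0 : E) R := by
      intro t ht
      rw [mem_closedBall, dist_zero_right] at ht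
      rw [zero_add, mem_ball, dist_zero_right, norm_smul]
      calc ‖t‖ * ‖v‖ ≤ ρ / ‖v‖ * ‖v‖ := mul_le_mul_of_nonneg_right ht (norm_nonneg _)
        _ = ρ := div_mul_cancel₀ ρ hv'.ne'
        _ < R := hρR
    have h := SCV.norm_fderiv_apply_le hf isOpen_ball hr hsub
      (fun t ht => hS _ (hsub t (sphere_subset_closedBall ht)))
    calc ‖fderiv ℂ f 0 v‖ ≤ S / (ρ / ‖v‖) := h
      _ = S / ρ * ‖v‖ := by field_simp
  -- `ρ ↑ R`
  have hc : ContinuousAt (fun ρ : ℝ => S / ρ * ‖v‖) R :=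
    (continuousAt_const.div continuousAt_id hR.ne').mul continuousAt_const
  have ht : Tendsto (fun ρ : ℝ => S / ρ * ‖v‖) (𝓝[<] R) (𝓝 (S / R * ‖v‖)) :=
    hc.tendsto.mono_left nhdsWithin_le_nhds
  refine ge_of_tendsto ht ?_
  have e1 : ∀ᶠ ρ in 𝓝[<] R, ρ ∈ Set.Iio R := eventually_mem_nhdsWithin
  have e2 : ∀ᶠ ρ in 𝓝[<] R, 0 < ρ := (eventually_gt_nhds hR).filter_mono nhdsWithin_le_nhds
  filter_upwards [e1, e2] with ρ hρR hρ using key ρ hρ hρR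

end Jet2

/-! ## §7  JET AGREEMENT AT THE BASE POINT: symmetry of the mixed derivative; the jet polynomial `jet2 f` has at `0` the same
first derivative and the same mixed second derivatives as `f`, in every pair of directions -/

section JetAgreement

variable {E : Type*} [NormedAddCommGroup E] [NormedSpace ℂ E]

/-- **Symmetry of the mixed derivative** of a function complex-differentiable on a ball of a complex normed space: the
Fréchet derivative is itself Fréchet-differentiable there (tree `HolomorphicBanach.hasFDerivAt_fderiv`, [Chae1985] Thm
14.13 — the Banach-domain upgrade), so `∂²f(v,w) = D²f(0)[w][v]` (tree `RemainderLocality.mixedDeriv_eq_fderiv_fderiv`) is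
symmetric (Mathlib `second_derivative_symmetric_of_eventually`) — Chae's Schwarz symmetric theorem 7.4 with 7.13 (commutativity of
directional derivatives), the twice-differentiability from 14.13; [folklore] relative to Mathlib. [cite: Chae1985, Thm 7.4, Thm 7.13, Thm 14.13] -/
theorem mixedDeriv_symm {f : E → ℂ} {ρ : ℝ} (hρ : 0 < ρ) (hf : DifferentiableOn ℂ f (ball 0 ρ)) (v w : E) :
    mixedDeriv f v w = mixedDeriv f w v := by
  obtain ⟨L, -, hLd⟩ := HolomorphicBanach.hasFDerivAt_fderiv hf isOpen_ball (mem_ball_self hρ)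
  have hev : ∀ᶠ y in 𝓝 (0 : E), HasFDerivAt f (fderiv ℂ f y) y := by
    filter_upwards [isOpen_ball.mem_nhds (mem_ball_self hρ)] with y hy
    exact (hf.differentiableAt (isOpen_ball.mem_nhds hy)).hasFDerivAt
  have hsymm := second_derivative_symmetric_of_eventually hev hLd
  rw [Beta.RemainderLocality.mixedDeriv_eq_fderiv_fderiv hLd.differentiableAt,
    Beta.RemainderLocality.mixedDeriv_eq_fderiv_fderiv hLd.differentiableAt, hLd.fderiv]
  exact hsymm w v

/-- `∂²f(0,w) = 0` ([folklore]). -/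
private theorem mixedDeriv_zero_left' (f : E → ℂ) (w : E) : mixedDeriv f 0 w = 0 := by
  simp [mixedDeriv]

/-- `∂²f(v,0) = 0` ([folklore]). -/
private theorem mixedDeriv_zero_right' (f : E → ℂ) (v : E) : mixedDeriv f v 0 = 0 := by
  simp [mixedDeriv]

/-- The Fréchet derivative of the jet polynomial at a point `p`: `D(jet2 f)(p)v' = Df(0)v' + ½(∂²f(p,v') + ∂²f(v',p))`
(Chae 8.7 `dT_{2,f,0} = T_{1,df,0}`, written out; [folklore] relative to Mathlib). [cite: Chae1985, Thm 8.7, Thm 5.14] -/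
theorem hasFDerivAt_jet2 {f : E → ℂ} {ρ K₂ : ℝ} (hρ : 0 < ρ) (hf : DifferentiableOn ℂ f (ball 0 ρ))
    (h2 : ∀ v w, ‖mixedDeriv f v w‖ ≤ K₂ * ‖v‖ * ‖w‖) (p : E) :
    HasFDerivAt (jet2 f) (fderiv ℂ f 0 + (1 / 2 : ℂ) • ((isBoundedBilinearMap_mixedDeriv hρ hf h2).deriv (p, p)).comp
      ((ContinuousLinearMap.id ℂ E).prod (ContinuousLinearMap.id ℂ E))) p := by
  have hB := isBoundedBilinearMap_mixedDeriv hρ hf h2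
  have hd : HasFDerivAt (fun v : E => (v, v)) ((ContinuousLinearMap.id ℂ E).prod (ContinuousLinearMap.id ℂ E)) p :=
    (hasFDerivAt_id p).prodMk (hasFDerivAt_id p)
  have hq : HasFDerivAt ((fun q : E × E => mixedDeriv f q.1 q.2) ∘ (fun v : E => (v, v)))
      ((hB.deriv (p, p)).comp ((ContinuousLinearMap.id ℂ E).prod (ContinuousLinearMap.id ℂ E))) p :=
    HasFDerivAt.comp p (hB.hasFDerivAt (p, p)) hd
  have hsum := ((hasFDerivAt_const (f 0) p).add (fderiv ℂ f 0).hasFDerivAt).add (hq.const_mul (1 / 2 : ℂ))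
  rw [zero_add] at hsum
  exact hsum

/-- **FIRST-ORDER AGREEMENT**: `D(jet2 f)(0) = Df(0)` (Chae 8.7 at `x = ξ = 0`). [cite: Chae1985, Thm 8.7] -/
theorem fderiv_jet2_zero {f : E → ℂ} {ρ K₂ : ℝ} (hρ : 0 < ρ) (hf : DifferentiableOn ℂ f (ball 0 ρ))
    (h2 : ∀ v w, ‖mixedDeriv f v w‖ ≤ K₂ * ‖v‖ * ‖w‖) : fderiv ℂ (jet2 f) 0 = fderiv ℂ f 0 := by
  rw [(hasFDerivAt_jet2 hρ hf h2 0).fderiv]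
  ext v
  simp [IsBoundedBilinearMap.deriv_apply, mixedDeriv_zero_left', mixedDeriv_zero_right']

/-- **SECOND-ORDER AGREEMENT**: `∂²(jet2 f)(v, w) = ∂²f(v, w)` for EVERY pair of directions (the jet polynomial carries the
diagonal `∂²f(v,v)` only; polarisation + symmetry `mixedDeriv_symm` recover the off-diagonal values — in particular the
wall's read-out directions `(t 0, t z)`, `Beta.RemainderStepAdapterHolo` :366); Chae 8.7 twice + polarization 4.6 + Schwarz 7.4.
[cite: Chae1985, Thm 8.7, Thm 4.6, Thm 7.4; Balaban1987RG1, (1.22) p.264] -/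
theorem mixedDeriv_jet2 {f : E → ℂ} {ρ K₂ : ℝ} (hρ : 0 < ρ) (hf : DifferentiableOn ℂ f (ball 0 ρ))
    (h2 : ∀ v w, ‖mixedDeriv f v w‖ ≤ K₂ * ‖v‖ * ‖w‖) (v w : E) : mixedDeriv (jet2 f) v w = mixedDeriv f v w := by
  have hB := isBoundedBilinearMap_mixedDeriv hρ hf h2
  have hF : ∀ τ : ℂ, fderiv ℂ (jet2 f) (τ • w) v = fderiv ℂ f 0 v + τ * mixedDeriv f v w := by
    intro τ
    rw [(hasFDerivAt_jet2 hρ hf h2 (τ • w)).fderiv]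
    simp only [_root_.add_apply, _root_.smul_apply, ContinuousLinearMap.comp_apply,
      ContinuousLinearMap.prod_apply, ContinuousLinearMap.id_apply, IsBoundedBilinearMap.deriv_apply, smul_eq_mul]
    rw [mixedDeriv_smul_left hρ hf, mixedDeriv_smul_right hρ hf, mixedDeriv_symm hρ hf w v]
    ring
  show deriv (fun τ : ℂ => fderiv ℂ (jet2 f) (τ • w) v) 0 = mixedDeriv f v w
  rw [show (fun τ : ℂ => fderiv ℂ (jet2 f) (τ • w) v) = fun τ => fderiv ℂ f 0 v + τ * mixedDeriv f v w from funext hF]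
  simp

end JetAgreement

/-! ## §8  THE ORDER-TWO CHAIN RULE AND JET TRANSPORT

A composite `Φ ∘ k` — `k : E → M` a holomorphic germ at `0`, `Φ : M → ℂ` holomorphic near `k 0` — is read here ONLY through its value,
its first derivative and its mixed second derivatives at the base point `0`.  These three are FUNCTIONS OF THE SECOND-ORDER JET OF
`k` AT `0` (and of `Φ` near `k 0`): the order-two chain rule on a complex normed space, with the Banach-domain upgrade
`HolomorphicBanach.hasFDerivAt_fderiv` ([Chae1985] Thm 14.13) supplying the second differentials.  Hence two holomorphic germs `k`, `k'`
with the same second-order jet at `0` give composites with the same second-order jet at `0` (`jet_transport`); entrywise form for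
`M = ι → ℂ` (`jet_transport_pi`).  (The memo companion's kernel-level corollaries — nomination N2 — are not part of this module.) -/

section Transport

variable {E : Type*} [NormedAddCommGroup E] [NormedSpace ℂ E]
variable {M : Type*} [NormedAddCommGroup M] [NormedSpace ℂ M] [CompleteSpace M]

/-- The jet polynomial depends only on the GERM of `f` at `0` ([folklore] locality of `fderiv`∕`deriv`; Chae 8.6's `T_{2,f,0}` is built
from `d^k f(0)` alone). [cite: Chae1985, 8.6] -/
theorem jet2_congr {f g : E → ℂ} (h : f =ᶠ[𝓝 0] g) : jet2 f = jet2 g := by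
  have h0 : f 0 = g 0 := h.eq_of_nhds
  have h1 : fderiv ℂ f 0 = fderiv ℂ g 0 := h.fderiv_eq
  have h2 : ∀ v w : E, mixedDeriv f v w = mixedDeriv g v w := by
    intro v w
    have hc : Tendsto (fun τ : ℂ => τ • w) (𝓝 0) (𝓝 (0 : E)) := by
      have : Continuous (fun τ : ℂ => τ • w) := continuous_id.smul continuous_const
      simpa using this.tendsto 0
    have hev : (fun τ : ℂ => fderiv ℂ f (τ • w) v) =ᶠ[𝓝 0] (fun τ => fderiv ℂ g (τ • w) v) := by
      filter_upwards [hc.eventually (h.fderiv (𝕜 := ℂ))] with τ hτ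
      rw [hτ]
    show deriv (fun τ : ℂ => fderiv ℂ f (τ • w) v) 0 = deriv (fun τ : ℂ => fderiv ℂ g (τ • w) v) 0
    exact hev.deriv_eq
  funext v
  simp only [jet2, h0, h1, h2]

/-- **THE ORDER-TWO CHAIN FORMULA** for `Φ ∘ k` at `0` (`Φ` holomorphic on an open set of a complete complex normed space
`M`, `k` a holomorphic germ `E → M` through it): `D(Φ∘k)(0) = DΦ(k0)∘Dk(0)` and
`∂²(Φ∘k)(v,w) = DΦ(k0)[∂_w∂_v k(0)] + ∂_{Dk(0)w}∂_{Dk(0)v}Φ(k0)`, the second differentials being those of the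
Banach-domain upgrade (`HolomorphicBanach.hasFDerivAt_fderiv`, [Chae1985] Thm 14.13) — Chae's chain rule 5.9 differentiated once more
(7.13); print's instance: [I] (4.3), the composite effective action differentiated by Cauchy integrals; [folklore] relative to Mathlib.
[cite: Chae1985, Thm 5.9, Thm 7.13, Thm 14.13; Balaban1987RG1, (4.3) p.281] -/
theorem chain_formula {Φ : M → ℂ} {U : Set M} (hU : IsOpen U) (hΦ : DifferentiableOn ℂ Φ U)
    {k : E → M} {ρ : ℝ} (hρ : 0 < ρ) (hk : DifferentiableOn ℂ k (ball 0 ρ)) (hkU : MapsTo k (ball 0 ρ) U) :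
    fderiv ℂ (Φ ∘ k) 0 = (fderiv ℂ Φ (k 0)).comp (fderiv ℂ k 0) ∧
    ∀ v w : E, mixedDeriv (Φ ∘ k) v w =
      fderiv ℂ Φ (k 0) (fderiv ℂ (fun y => fderiv ℂ k y v) 0 w)
        + fderiv ℂ (fun m => fderiv ℂ Φ m (fderiv ℂ k 0 v)) (k 0) (fderiv ℂ k 0 w) := by
  have h0ball : (0 : E) ∈ ball (0 : E) ρ := mem_ball_self hρ
  have hkd : ∀ y ∈ ball (0 : E) ρ, HasFDerivAt k (fderiv ℂ k y) y := fun y hy =>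
    (hk.differentiableAt (isOpen_ball.mem_nhds hy)).hasFDerivAt
  have hΦd : ∀ y ∈ ball (0 : E) ρ, HasFDerivAt Φ (fderiv ℂ Φ (k y)) (k y) := fun y hy =>
    (hΦ.differentiableAt (hU.mem_nhds (hkU hy))).hasFDerivAt
  have hcomp : ∀ y ∈ ball (0 : E) ρ, HasFDerivAt (Φ ∘ k) ((fderiv ℂ Φ (k y)).comp (fderiv ℂ k y)) y :=
    fun y hy => (hΦd y hy).comp y (hkd y hy)
  refine ⟨(hcomp 0 h0ball).fderiv, fun v w => ?_⟩
  obtain ⟨LΦ, hLΦ, hLΦd⟩ := HolomorphicBanach.hasFDerivAt_fderiv hΦ hU (hkU h0ball)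
  obtain ⟨Lk, hLk, hLkd⟩ := HolomorphicBanach.hasFDerivAt_fderiv hk isOpen_ball h0ball
  have hc : HasFDerivAt (fun y => fderiv ℂ Φ (k y)) (LΦ.comp (fderiv ℂ k 0)) 0 := hLΦd.comp 0 (hkd 0 h0ball)
  have hcd := hc.clm_comp hLkd
  have hev : fderiv ℂ (Φ ∘ k) =ᶠ[𝓝 0] fun y => (fderiv ℂ Φ (k y)).comp (fderiv ℂ k y) := by
    filter_upwards [isOpen_ball.mem_nhds h0ball] with y hy using (hcomp y hy).fderiv
  have h2 := hcd.congr_of_eventuallyEq hev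
  rw [Beta.RemainderLocality.mixedDeriv_eq_fderiv_fderiv h2.differentiableAt, h2.fderiv]
  simp only [_root_.add_apply, ContinuousLinearMap.comp_apply, ContinuousLinearMap.compL_apply,
    ContinuousLinearMap.flip_apply]
  rw [hLk, hLΦ]

/-- **JET TRANSPORT** (abstract form of price (J2)): two holomorphic germs `k, k' : E → M` through the domain of a
holomorphic `Φ : M → ℂ` with THE SAME SECOND-ORDER JET AT `0` (value, first derivative, second directional derivatives)
give objects `Φ ∘ k`, `Φ ∘ k'` with the same value, the same first derivative and the same mixed second derivatives at
`0` — i.e. the same data in each of the wall's three read-outs (value, (1.21)-type first and (1.22)-type second derivatives at the zero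
field). [cite: Chae1985, Thm 5.9, Thm 7.13, Thm 14.13; Balaban1987RG1, (4.3) p.281, (1.20)–(1.22) p.264] -/
theorem jet_transport {Φ : M → ℂ} {U : Set M} (hU : IsOpen U) (hΦ : DifferentiableOn ℂ Φ U)
    {k k' : E → M} {ρ : ℝ} (hρ : 0 < ρ)
    (hk : DifferentiableOn ℂ k (ball 0 ρ)) (hk' : DifferentiableOn ℂ k' (ball 0 ρ))
    (hkU : MapsTo k (ball 0 ρ) U) (hk'U : MapsTo k' (ball 0 ρ) U)
    (h0 : k 0 = k' 0) (h1 : fderiv ℂ k 0 = fderiv ℂ k' 0)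
    (h2 : ∀ v w : E, fderiv ℂ (fun y => fderiv ℂ k y v) 0 w = fderiv ℂ (fun y => fderiv ℂ k' y v) 0 w) :
    (Φ ∘ k) 0 = (Φ ∘ k') 0 ∧ fderiv ℂ (Φ ∘ k) 0 = fderiv ℂ (Φ ∘ k') 0 ∧
    ∀ v w : E, mixedDeriv (Φ ∘ k) v w = mixedDeriv (Φ ∘ k') v w := by
  obtain ⟨f1, f2⟩ := chain_formula hU hΦ hρ hk hkU
  obtain ⟨g1, g2⟩ := chain_formula hU hΦ hρ hk' hk'U
  refine ⟨by simp only [Function.comp_apply, h0], by rw [f1, g1, h0, h1], fun v w => ?_⟩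
  rw [f2, g2, h0, h1, h2]

/-! ### §8b  Entrywise form (`M = ι → ℂ`, `ι` finite): the hypotheses are literally §2b + §7 -/

/-- Coordinates of the first derivative of a map into `ι → ℂ` ([folklore]; Chae 5.12). -/
private theorem pi_first {ι : Type*} [Fintype ι] (k : E → ι → ℂ) {ρ : ℝ} (hρ : 0 < ρ)
    (hk : ∀ i, DifferentiableOn ℂ (fun u => k u i) (ball 0 ρ)) (w : E) (i : ι) :
    fderiv ℂ k 0 w i = fderiv ℂ (fun u => k u i) 0 w := by
  have hkd : DifferentiableOn ℂ k (ball 0 ρ) := differentiableOn_pi.2 hk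
  rw [fderiv_apply (hkd.differentiableAt (isOpen_ball.mem_nhds (mem_ball_self hρ))) i]
  rfl

/-- Coordinates of the second derivative of a map into `ι → ℂ` ([folklore]; Chae 5.12, 7.13). -/
private theorem pi_second {ι : Type*} [Fintype ι] (k : E → ι → ℂ) {ρ : ℝ} (hρ : 0 < ρ)
    (hk : ∀ i, DifferentiableOn ℂ (fun u => k u i) (ball 0 ρ)) (v w : E) (i : ι) :
    fderiv ℂ (fun y => fderiv ℂ k y v) 0 w i = mixedDeriv (fun u => k u i) v w := by
  have hkd : DifferentiableOn ℂ k (ball 0 ρ) := differentiableOn_pi.2 hk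
  have h0 : (0 : E) ∈ ball (0 : E) ρ := mem_ball_self hρ
  obtain ⟨L, -, hLd⟩ := HolomorphicBanach.hasFDerivAt_fderiv hkd isOpen_ball h0
  have hΨ : DifferentiableAt ℂ (fun y => fderiv ℂ k y v) 0 :=
    hLd.differentiableAt.clm_apply (differentiableAt_const v)
  have e1 : fderiv ℂ (fun y => fderiv ℂ k y v) 0 w i = fderiv ℂ (fun y => fderiv ℂ k y v i) 0 w := by
    rw [fderiv_apply hΨ i]
    rfl
  rw [e1]
  have hev : (fun y => fderiv ℂ k y v i) =ᶠ[𝓝 0] fun y => fderiv ℂ (fun u => k u i) y v := by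
    filter_upwards [isOpen_ball.mem_nhds h0] with y hy
    rw [fderiv_apply (hkd.differentiableAt (isOpen_ball.mem_nhds hy)) i]
    rfl
  rw [hev.fderiv_eq]
  obtain ⟨Li, hLi, hLid⟩ := HolomorphicBanach.hasFDerivAt_fderiv (hk i) isOpen_ball h0
  rw [Beta.RemainderLocality.mixedDeriv_eq_fderiv_fderiv hLid.differentiableAt, hLid.fderiv, hLi]

/-- **JET TRANSPORT, ENTRYWISE FORM**: `k, k' : E → (ι → ℂ)` holomorphic germs whose ENTRIES have the same value, the
same first derivative and the same mixed second derivatives at `0` (the currency of §2b + §7) give, for every holomorphic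
`Φ` of the entries, objects `Φ ∘ k`, `Φ ∘ k'` with the same second-order jet at `0`.
[cite: Chae1985, Thm 5.9, Thm 7.13, Thm 14.13; Balaban1987RG1, (4.3) p.281, (1.20)–(1.22) p.264] -/
theorem jet_transport_pi {ι : Type*} [Fintype ι] {Φ : (ι → ℂ) → ℂ} {U : Set (ι → ℂ)} (hU : IsOpen U)
    (hΦ : DifferentiableOn ℂ Φ U) {k k' : E → ι → ℂ} {ρ : ℝ} (hρ : 0 < ρ)
    (hk : ∀ i, DifferentiableOn ℂ (fun u => k u i) (ball 0 ρ))
    (hk' : ∀ i, DifferentiableOn ℂ (fun u => k' u i) (ball 0 ρ))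
    (hkU : MapsTo k (ball 0 ρ) U) (hk'U : MapsTo k' (ball 0 ρ) U)
    (h0 : ∀ i, k 0 i = k' 0 i)
    (h1 : ∀ i, fderiv ℂ (fun u => k u i) 0 = fderiv ℂ (fun u => k' u i) 0)
    (h2 : ∀ i (v w : E), mixedDeriv (fun u => k u i) v w = mixedDeriv (fun u => k' u i) v w) :
    (Φ ∘ k) 0 = (Φ ∘ k') 0 ∧ fderiv ℂ (Φ ∘ k) 0 = fderiv ℂ (Φ ∘ k') 0 ∧
    ∀ v w : E, mixedDeriv (Φ ∘ k) v w = mixedDeriv (Φ ∘ k') v w := by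
  have hkd : DifferentiableOn ℂ k (ball 0 ρ) := differentiableOn_pi.2 hk
  have hkd' : DifferentiableOn ℂ k' (ball 0 ρ) := differentiableOn_pi.2 hk'
  refine jet_transport hU hΦ hρ hkd hkd' hkU hk'U (funext h0) ?_ ?_
  · ext w i
    rw [pi_first k hρ hk w i, pi_first k' hρ hk' w i, h1 i]
  · intro v w
    funext i
    rw [pi_second k hρ hk v w i, pi_second k' hρ hk' v w i, h2 i v w]

end Transport

end Literature.MathematicalPhysics.QuantumFieldTheory.Balaban1983to89.NodeOJetCalculus

end
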